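import Summits.CriticalPhenomena.SAWScalingLimit.Theorems.SAWTotalPositivityCriticalBubbleBoundJoinSurgeryDefs
import Summits.CriticalPhenomena.SAWScalingLimit.Theorems.SAWTotalPositivityCriticalBubbleBoundJoinReplace
import Summits.CriticalPhenomena.SAWScalingLimit.Theorems.SAWTotalPositivityCriticalBubbleBoundDockingEntropyZero

/-!
# Madras' modification at the contact window, cases `Aup` / `Adown`
(stubs `modify_spec_Aup`, `modify_spec_Adown` of line `docking-census-joining`, crux
stmt-CriticalPhenomena-7117 `Summit.CriticalPhenomena.SAWScalingLimit.Theses.SAWTotalPositivity.CriticalBubbleBound`;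
lead c6, join-mass wave 2: the Madras surgery cases)

Let `E` be a polygon of `ℤ²` (`IsPolygon`), `Y` a site whose right corridor
`{Y + (s, t) : s ≥ 1, -1 ≤ t ≤ 1}` contains no vertex of `E`, and suppose `Y` is a vertex of `E`
(cases `A` of `caseOf`). In case `Aup` the vertical edge `{Y, Y + e₁}` belongs to `E`; in case `Adown`
it does not, and since `Y + e₀` lies in the corridor, the two edges of `E` at `Y` are `{Y, Y - e₀}` and
`{Y, Y - e₁}`, so `{Y - e₁, Y}` belongs to `E`. The modification `modify E Y` replaces that one edge
by the explicit nine-edge excursion `pathPts` through the corridor columns `Y 0 + 1 … Y 0 + 3`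
(all eight interior sites are corridor sites, hence fresh), and everything is read off the landed
replacement lemma `isPolygon_replace_edge`: the result is a polygon with `#E + 8` edges containing
the vertical 2-segment of column `Y 0 + 3`, its vertices in the three window rows have abscissa
`≤ Y 0 + 3`, its vertices are old vertices or interior path sites, every old vertex survives, and
removing the path and restoring the edge gives `E` back.

Source: N. Madras, J. Statist. Phys. 78 (1995) via A. Hammond, Ann. Probab. 46 (2018)
= arXiv:1808.09032, §4.1 (the procedure); the verification itself is elementary ([folklore]).
-/

noncomputable section

open SimpleGraph
open Literature.Probability.LatticeModels
open Literature.Probability.RandomPlanarGeometry Literature.Probability.RandomPlanarGeometry.SAW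
open scoped BigOperators
open Summit.CriticalPhenomena.SAWScalingLimit.Theorems.CriticalBubbleBound.Negative (e₀)
open Summit.CriticalPhenomena.SAWScalingLimit.Theorems.CriticalBubbleBound.Docking

namespace Summit.CriticalPhenomena.SAWScalingLimit.Theorems.CriticalBubbleBound.Join

/-! ## Relative sites `pt Y d` -/

/-- Coordinates of the relative site `pt Y d = Y + d`. [folklore] -/
private theorem pt_apply (Y : Site 2) (d : ℤ × ℤ) : pt Y d 0 = Y 0 + d.1 ∧ pt Y d 1 = Y 1 + d.2 := by
  simp [pt]

/-- `d ↦ pt Y d` is injective. [folklore] -/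
private theorem pt_injective (Y : Site 2) : Function.Injective (pt Y) := by
  intro d d' h
  have h0 := congrFun h 0
  have h1 := congrFun h 1
  rw [(pt_apply Y d).1, (pt_apply Y d').1] at h0
  rw [(pt_apply Y d).2, (pt_apply Y d').2] at h1
  exact Prod.ext (by omega) (by omega)

/-- `pt Y (0, 0) = Y`. [folklore] -/
private theorem pt_zero (Y : Site 2) : pt Y (0, 0) = Y := by
  funext i
  fin_cases i <;> simp [pt]

/-- `pt Y (0, -1) = Y - e₁`. [folklore] -/
private theorem pt_down (Y : Site 2) : pt Y (0, -1) = Y - e₁ := by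
  funext i
  fin_cases i <;> simp [pt, e₀_e₁_apply, sub_eq_add_neg]

/-- One lattice step to the right or upwards between relative sites. [folklore] -/
private theorem adj_pt (Y : Site 2) (d d' : ℤ × ℤ)
    (h : (d'.1 = d.1 + 1 ∧ d'.2 = d.2) ∨ (d'.1 = d.1 ∧ d'.2 = d.2 + 1)) :
    (zdGraph 2).Adj (pt Y d) (pt Y d') := by
  rw [zdGraph_adj_iff]
  rcases h with ⟨h1, h2⟩ | ⟨h1, h2⟩
  · refine ⟨0, Or.inl ?_⟩
    funext i
    fin_cases i <;> simp [pt, Matrix.vecHead, Matrix.vecTail] <;> omega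
  · refine ⟨1, Or.inl ?_⟩
    funext i
    fin_cases i <;> simp [pt, Matrix.vecHead, Matrix.vecTail] <;> omega

/-! ## The two nine-edge excursions -/

/-- The added path of case `Aup` exists as a lattice walk `Y → Y+e₀ → … → Y+e₁` through the
corridor, with support `pathPts Aup`, the corresponding edge list, and length `9`.
[cite: Hammond2015SAPJoining, §4.1] -/
private theorem exists_walk_up (Y : Site 2) : ∃ P : (zdGraph 2).Walk (pt Y (0, 0)) (pt Y (0, 1)),
    P.support = (pathPts JCase.Aup).map (pt Y) ∧
      P.edges = ((pathPts JCase.Aup).zip (pathPts JCase.Aup).tail).map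
        (fun q => s(pt Y q.1, pt Y q.2)) ∧ P.length = 9 :=
  ⟨Walk.cons (adj_pt Y (0, 0) (1, 0) (by decide)) <|
    Walk.cons (adj_pt Y (1, -1) (1, 0) (by decide)).symm <|
    Walk.cons (adj_pt Y (1, -1) (2, -1) (by decide)) <|
    Walk.cons (adj_pt Y (2, -1) (3, -1) (by decide)) <|
    Walk.cons (adj_pt Y (3, -1) (3, 0) (by decide)) <|
    Walk.cons (adj_pt Y (3, 0) (3, 1) (by decide)) <|
    Walk.cons (adj_pt Y (2, 1) (3, 1) (by decide)).symm <|
    Walk.cons (adj_pt Y (1, 1) (2, 1) (by decide)).symm <|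
    Walk.cons (adj_pt Y (0, 1) (1, 1) (by decide)).symm Walk.nil,
    rfl, rfl, rfl⟩

/-- The added path of case `Adown` exists as a lattice walk `Y → Y+e₀ → … → Y-e₁` through the
corridor, with support `pathPts Adown`, the corresponding edge list, and length `9`.
[cite: Hammond2015SAPJoining, §4.1] -/
private theorem exists_walk_down (Y : Site 2) : ∃ P : (zdGraph 2).Walk (pt Y (0, 0)) (pt Y (0, -1)),
    P.support = (pathPts JCase.Adown).map (pt Y) ∧
      P.edges = ((pathPts JCase.Adown).zip (pathPts JCase.Adown).tail).map
        (fun q => s(pt Y q.1, pt Y q.2)) ∧ P.length = 9 :=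
  ⟨Walk.cons (adj_pt Y (0, 0) (1, 0) (by decide)) <|
    Walk.cons (adj_pt Y (1, 0) (1, 1) (by decide)) <|
    Walk.cons (adj_pt Y (1, 1) (2, 1) (by decide)) <|
    Walk.cons (adj_pt Y (2, 1) (3, 1) (by decide)) <|
    Walk.cons (adj_pt Y (3, 0) (3, 1) (by decide)).symm <|
    Walk.cons (adj_pt Y (3, -1) (3, 0) (by decide)).symm <|
    Walk.cons (adj_pt Y (2, -1) (3, -1) (by decide)).symm <|
    Walk.cons (adj_pt Y (1, -1) (2, -1) (by decide)).symm <|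
    Walk.cons (adj_pt Y (0, -1) (1, -1) (by decide)).symm Walk.nil,
    rfl, rfl, rfl⟩

/-! ## Polygon bookkeeping -/

/-- Edges of a polygon of `ℤ²` are lattice edges. [folklore] -/
private theorem adj_of_mem {E : Finset (Sym2 (Site 2))} (hE : IsPolygon (zdGraph 2) E) {v x : Site 2}
    (h : s(v, x) ∈ E) : (zdGraph 2).Adj v x := by
  obtain ⟨u, c, -, rfl⟩ := hE
  exact c.adj_of_mem_edges (List.mem_toFinset.1 h)

/-- A vertex of a polygon lies on two edges: besides `s(v, x) ∈ E` there is another edge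
`s(v, z) ∈ E`, `z ≠ x`. [folklore] -/
private theorem exists_other_edge {E : Finset (Sym2 (Site 2))} (hE : IsPolygon (zdGraph 2) E)
    {v x : Site 2} (h : s(v, x) ∈ E) : ∃ z, z ≠ x ∧ s(v, z) ∈ E := by
  have hvx : v ≠ x := (adj_of_mem hE h).ne
  obtain ⟨P, -, hPe, -, -, -⟩ := hE.exists_isPath_erase h
  cases P with
  | nil => exact absurd rfl hvx
  | cons hadj P' =>
    rename_i z
    have hz : s(v, z) ∈ E.erase s(v, x) := by
      rw [← hPe, List.mem_toFinset, Walk.edges_cons]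
      exact List.mem_cons_self
    rw [Finset.mem_erase] at hz
    exact ⟨z, fun hzx => hz.1 (by rw [hzx]), hz.2⟩

/-- Case `Adown`: if `Y` is a vertex of the polygon `E`, `{Y, Y + e₁} ∉ E` and `Y + e₀` is not a
vertex, then `{Y, Y - e₁} ∈ E` (the two edges at `Y` go left and down). [folklore] -/
private theorem mem_down {E : Finset (Sym2 (Site 2))} {Y : Site 2} (hE : IsPolygon (zdGraph 2) E)
    (hY : IsV E Y) (hup : s(Y, Y + e₁) ∉ E) (hrt : ¬ IsV E (Y + e₀)) : s(Y, Y - e₁) ∈ E := by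
  obtain ⟨e, he, hYe⟩ := hY
  obtain ⟨x, rfl⟩ := Sym2.mem_iff_exists.1 hYe
  have key : ∀ w, s(Y, w) ∈ E → w = Y - e₀ ∨ w = Y - e₁ := by
    intro w hw
    rcases adj_cases (adj_of_mem hE hw) with rfl | rfl | rfl | rfl
    · exact absurd ⟨_, hw, Sym2.mem_mk_right _ _⟩ hrt
    · exact Or.inl rfl
    · exact absurd hw hup
    · exact Or.inr rfl
  obtain ⟨z, hzx, hz⟩ := exists_other_edge hE he
  rcases key x he with rfl | rfl
  · rcases key z hz with rfl | rfl
    · exact absurd rfl hzx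
    · exact hz
  · exact he

/-! ## The common verification -/

/-- Master lemma for the one-edge cases: if the removed edge `{pt Y d₀, pt Y d₁}` belongs to the
polygon `E`, the added path `P : pt Y d₀ ⇝ pt Y d₁` runs through the sites `pathPts c` whose interior
ones are corridor sites (hence not vertices of `E`), then `modify E Y` has the eight listed properties.
[folklore] -/
private theorem master {E : Finset (Sym2 (Site 2))} {Y : Site 2} (hE : IsPolygon (zdGraph 2) E)
    (hcorr : ∀ s t : ℤ, 1 ≤ s → -1 ≤ t → t ≤ 1 → ¬ IsV E (Y + ![s, t]))
    {c : JCase} (hc : caseOf E Y = c) {d₀ d₁ : ℤ × ℤ} (P : (zdGraph 2).Walk (pt Y d₀) (pt Y d₁))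
    (hab : s(pt Y d₀, pt Y d₁) ∈ E) (hRe : removedE c Y = {s(pt Y d₀, pt Y d₁)})
    (hPs : P.support = (pathPts c).map (pt Y))
    (hPl : P.edges = ((pathPts c).zip (pathPts c).tail).map fun q => s(pt Y q.1, pt Y q.2))
    (hlen : P.length = 9) (hnd : (pathPts c).Nodup)
    (hint : ∀ d ∈ pathPts c, d = d₀ ∨ d = d₁ ∨
      (d ∈ (pathPts c).tail.dropLast ∧ 1 ≤ d.1 ∧ -1 ≤ d.2 ∧ d.2 ≤ 1))
    (hx3 : ∀ d ∈ pathPts c, d.1 ≤ 3)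
    (hze : ∀ q ∈ (pathPts c).zip (pathPts c).tail,
      (1 ≤ q.1.1 ∧ -1 ≤ q.1.2 ∧ q.1.2 ≤ 1) ∨ (1 ≤ q.2.1 ∧ -1 ≤ q.2.2 ∧ q.2.2 ≤ 1))
    (h3 : ((3, -1), (3, 0)) ∈ (pathPts c).zip (pathPts c).tail ∨
      ((3, 0), (3, -1)) ∈ (pathPts c).zip (pathPts c).tail)
    (h4 : ((3, 0), (3, 1)) ∈ (pathPts c).zip (pathPts c).tail ∨
      ((3, 1), (3, 0)) ∈ (pathPts c).zip (pathPts c).tail) :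
    IsPolygon (zdGraph 2) (modify E Y) ∧ (modify E Y).card = E.card + 8 ∧
      s(pt Y (3, -1), pt Y (3, 0)) ∈ modify E Y ∧ s(pt Y (3, 0), pt Y (3, 1)) ∈ modify E Y ∧
      (∀ p : Site 2, IsV (modify E Y) p → -1 ≤ p 1 - Y 1 → p 1 - Y 1 ≤ 1 → p 0 ≤ Y 0 + 3) ∧
      (∀ p : Site 2, IsV (modify E Y) p → IsV E p ∨ p ∈ newCells c Y) ∧
      (∀ p : Site 2, IsV E p → IsV (modify E Y) p) ∧ unmodify c (modify E Y) Y = E := by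
  -- the path is self-avoiding, its interior is fresh
  have hP : P.IsPath := by
    rw [Walk.isPath_def, hPs]
    exact hnd.map (pt_injective Y)
  have hfresh : ∀ x ∈ P.support, x ≠ pt Y d₀ → x ≠ pt Y d₁ → ¬ ∃ e ∈ E, x ∈ e := by
    intro x hx hxa hxb
    rw [hPs, List.mem_map] at hx
    obtain ⟨d, hd, rfl⟩ := hx
    rcases hint d hd with rfl | rfl | ⟨-, h1, h2, h3⟩
    · exact absurd rfl hxa
    · exact absurd rfl hxb
    · exact hcorr d.1 d.2 h1 h2 h3
  -- vertices of path edges are path sites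
  have hsup : ∀ {e : Sym2 (Site 2)} {p : Site 2}, e ∈ P.edges.toFinset → p ∈ e →
      ∃ d ∈ pathPts c, pt Y d = p := by
    intro e p he hp
    obtain ⟨y, rfl⟩ := Sym2.mem_iff_exists.1 hp
    have h := P.fst_mem_support_of_mem_edges (List.mem_toFinset.1 he)
    rwa [hPs, List.mem_map] at h
  -- no path edge is an edge of `E`
  have hdisj : Disjoint (E.erase s(pt Y d₀, pt Y d₁)) P.edges.toFinset := by
    rw [Finset.disjoint_left]
    intro e he heP
    rw [List.mem_toFinset, hPl, List.mem_map] at heP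
    obtain ⟨q, hq, rfl⟩ := heP
    have he' := Finset.mem_of_mem_erase he
    rcases hze q hq with ⟨h1, h2, h3⟩ | ⟨h1, h2, h3⟩
    · exact hcorr _ _ h1 h2 h3 ⟨_, he', Sym2.mem_mk_left _ _⟩
    · exact hcorr _ _ h1 h2 h3 ⟨_, he', Sym2.mem_mk_right _ _⟩
  -- identify `modify E Y` with the output of the replacement lemma
  have hPe : addedE c Y = P.edges.toFinset := by
    rw [hPl]
    rfl
  have hM : modify E Y = E.erase s(pt Y d₀, pt Y d₁) ∪ P.edges.toFinset := by
    rw [modify, hc, hRe, hPe, Finset.sdiff_singleton_eq_erase]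
  -- the output segment consists of path edges
  have hmemP : ∀ q ∈ (pathPts c).zip (pathPts c).tail, s(pt Y q.1, pt Y q.2) ∈ P.edges := by
    intro q hq
    rw [hPl]
    exact List.mem_map.2 ⟨q, hq, rfl⟩
  have h3' : s(pt Y (3, -1), pt Y (3, 0)) ∈ P.edges := by
    rcases h3 with h | h
    · exact hmemP _ h
    · rw [Sym2.eq_swap]
      exact hmemP _ h
  have h4' : s(pt Y (3, 0), pt Y (3, 1)) ∈ P.edges := by
    rcases h4 with h | h
    · exact hmemP _ h
    · rw [Sym2.eq_swap]
      exact hmemP _ h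
  obtain ⟨hpoly, hcard⟩ := isPolygon_replace_edge E _ _ P hE hab hP (by omega) hfresh
  rw [hM]
  refine ⟨hpoly, by omega, Finset.mem_union_right _ (List.mem_toFinset.2 h3'),
    Finset.mem_union_right _ (List.mem_toFinset.2 h4'), ?_, ?_, ?_, ?_⟩
  · -- window rows: abscissa at most `Y 0 + 3`
    rintro p ⟨e, he, hpe⟩ h1 h2
    rw [Finset.mem_union] at he
    rcases he with he | he
    · by_contra hlt
      have hp : Y + ![p 0 - Y 0, p 1 - Y 1] = p := by
        funext i
        fin_cases i <;> simp
      refine hcorr (p 0 - Y 0) (p 1 - Y 1) (by omega) h1 h2 ?_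
      rw [hp]
      exact ⟨e, Finset.mem_of_mem_erase he, hpe⟩
    · obtain ⟨d, hd, rfl⟩ := hsup he hpe
      rw [(pt_apply Y d).1]
      have := hx3 d hd
      omega
  · -- vertices are old vertices or interior path sites
    rintro p ⟨e, he, hpe⟩
    rw [Finset.mem_union] at he
    rcases he with he | he
    · exact Or.inl ⟨e, Finset.mem_of_mem_erase he, hpe⟩
    · obtain ⟨d, hd, rfl⟩ := hsup he hpe
      rcases hint d hd with rfl | rfl | ⟨h, -⟩
      · exact Or.inl ⟨_, hab, Sym2.mem_mk_left _ _⟩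
      · exact Or.inl ⟨_, hab, Sym2.mem_mk_right _ _⟩
      · refine Or.inr ?_
        rw [newCells, List.mem_toFinset, List.mem_map]
        exact ⟨d, h, rfl⟩
  · -- old vertices survive
    rintro p ⟨e, he, hpe⟩
    by_cases hes : e = s(pt Y d₀, pt Y d₁)
    · subst hes
      have hp : p ∈ P.support := by
        rcases Sym2.mem_iff.1 hpe with rfl | rfl
        exacts [P.start_mem_support, P.end_mem_support]
      have hnil : ¬ P.Nil := by
        rw [Walk.not_nil_iff_lt_length]
        omega
      obtain ⟨e', he', hpe'⟩ := (Walk.mem_support_iff_exists_mem_edges_of_not_nil hnil).1 hp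
      exact ⟨e', Finset.mem_union_right _ (List.mem_toFinset.2 he'), hpe'⟩
    · exact ⟨e, Finset.mem_union_left _ (Finset.mem_erase.2 ⟨hes, he⟩), hpe⟩
  · -- the explicit inverse
    rw [unmodify, hRe, hPe, Finset.union_sdiff_cancel_right hdisj, Finset.union_comm,
      ← Finset.insert_eq, Finset.insert_erase hab]

/-! ## The two registered cases -/

/-- **Case `Aup` of Madras' modification.** If `Y` is a vertex of the polygon `E` with
`{Y, Y + e₁} ∈ E` and the right corridor of `Y` is vertex-free, then `modify E Y` (replace
`{Y, Y + e₁}` by the nine-edge excursion through columns `Y 0 + 1 … Y 0 + 3`) is a polygon with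
`#E + 8` edges containing the vertical 2-segment of column `Y 0 + 3`, with the window, vertex,
survival and inversion properties. [cite: Hammond2015SAPJoining, §4.1] -/
theorem modify_spec_Aup : ∀ (E : Finset (Sym2 (Site 2))) (Y : Site 2), IsPolygon (zdGraph 2) E → caseOf E Y = JCase.Aup → (∀ s t : ℤ, 1 ≤ s → -1 ≤ t → t ≤ 1 → ¬ IsV E (Y + ![s, t])) → IsPolygon (zdGraph 2) (modify E Y) ∧ (modify E Y).card = E.card + 8 ∧ s(pt Y (3, -1), pt Y (3, 0)) ∈ modify E Y ∧ s(pt Y (3, 0), pt Y (3, 1)) ∈ modify E Y ∧ (∀ p : Site 2, IsV (modify E Y) p → -1 ≤ p 1 - Y 1 → p 1 - Y 1 ≤ 1 → p 0 ≤ Y 0 + 3) ∧ (∀ p : Site 2, IsV (modify E Y) p → IsV E p ∨ p ∈ newCells JCase.Aup Y) ∧ (∀ p : Site 2, IsV E p → IsV (modify E Y) p) ∧ unmodify JCase.Aup (modify E Y) Y = E := by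
  intro E Y hE hc hcorr
  have hab : s(pt Y (0, 0), pt Y (0, 1)) ∈ E := by
    have h := hc
    simp only [caseOf] at h
    split_ifs at h with h1 h2
    rw [pt_zero]
    exact h2
  obtain ⟨P, hPs, hPl, hlen⟩ := exists_walk_up Y
  exact master hE hcorr hc P hab (by simp [removedE, remPairs]) hPs hPl hlen (by decide)
    (by decide) (by decide) (by decide) (by decide) (by decide)

/-- **Case `Adown` of Madras' modification.** If `Y` is a vertex of the polygon `E` with
`{Y, Y + e₁} ∉ E` and the right corridor of `Y` is vertex-free, then `{Y - e₁, Y} ∈ E` and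
`modify E Y` (replace it by the mirrored nine-edge excursion) is a polygon with `#E + 8` edges
containing the vertical 2-segment of column `Y 0 + 3`, with the window, vertex, survival and
inversion properties. [cite: Hammond2015SAPJoining, §4.1] -/
theorem modify_spec_Adown : ∀ (E : Finset (Sym2 (Site 2))) (Y : Site 2), IsPolygon (zdGraph 2) E → caseOf E Y = JCase.Adown → (∀ s t : ℤ, 1 ≤ s → -1 ≤ t → t ≤ 1 → ¬ IsV E (Y + ![s, t])) → IsPolygon (zdGraph 2) (modify E Y) ∧ (modify E Y).card = E.card + 8 ∧ s(pt Y (3, -1), pt Y (3, 0)) ∈ modify E Y ∧ s(pt Y (3, 0), pt Y (3, 1)) ∈ modify E Y ∧ (∀ p : Site 2, IsV (modify E Y) p → -1 ≤ p 1 - Y 1 → p 1 - Y 1 ≤ 1 → p 0 ≤ Y 0 + 3) ∧ (∀ p : Site 2, IsV (modify E Y) p → IsV E p ∨ p ∈ newCells JCase.Adown Y) ∧ (∀ p : Site 2, IsV E p → IsV (modify E Y) p) ∧ unmodify JCase.Adown (modify E Y) Y = E := by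
  intro E Y hE hc hcorr
  have hY : IsV E Y ∧ s(Y, Y + e₁) ∉ E := by
    have h := hc
    simp only [caseOf] at h
    split_ifs at h with h1 h2
    exact ⟨h1, h2⟩
  have hab : s(pt Y (0, 0), pt Y (0, -1)) ∈ E := by
    rw [pt_zero, pt_down]
    exact mem_down hE hY.1 hY.2 (hcorr 1 0 le_rfl (by norm_num) (by norm_num))
  have hRe : removedE JCase.Adown Y = {s(pt Y (0, 0), pt Y (0, -1))} := by
    rw [Sym2.eq_swap]
    simp [removedE, remPairs]
  obtain ⟨P, hPs, hPl, hlen⟩ := exists_walk_down Y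
  exact master hE hcorr hc P hab hRe hPs hPl hlen (by decide) (by decide) (by decide) (by decide)
    (by decide) (by decide)

end Summit.CriticalPhenomena.SAWScalingLimit.Theorems.CriticalBubbleBound.Join

end
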